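import Literature.NumberTheory.Automorphic.GL2ComplexCasimirScalar
import Literature.NumberTheory.Automorphic.GL2CasimirParameter
import HarnessLib

/-!
# The Harish-Chandra parameter of a `𝔤𝔩₂(ℂ)`-module from the scalars of the two real Casimir
# elements and of the centre (the complex-place companion of `GL2CasimirParameter`)

Topic `NumberTheory/Automorphic`; namespace `Literature.NumberTheory.Automorphic.GL2ComplexCasimir`.
Theorems only (no definition, no named fact; D-0026). CONVERSE of
`GL2ComplexCasimir.scalars_of_hasHCParameter` (`GL2ComplexCasimirScalar`: a `𝔤𝔩₂(ℂ)`-module —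
`𝔤𝔩₂(ℂ)` as a REAL Lie algebra, `U_ℂ = U(𝔤𝔩₂) ⊗ U(𝔤𝔩₂)` — of Harish-Chandra parameter
`χ(id) = {s₁, s₂}`, `χ(conj) = {t₁, t₂}` has `C₊ = 2(α + β)`, `C₋ = 2i(α - β)`,
`Z(1) = (s₁+s₂) + (t₁+t₂)`, `Z(i) = i((s₁+s₂) - (t₁+t₂))`, `α = s₁²+s₂²-½`, `β = t₁²+t₂²-½`):

* `GL2ComplexCasimir.hasHCParameter_of_lift_scalars` — if the centre of `U_ℝ(𝔤𝔩₂(ℂ))` acts through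
  SOME character (`HasCentralCharacter`; e.g. Schur's lemma on an irreducible `(𝔤, K)`-module, or
  the infinitesimal character of an automorphic representation restricted to a complex place) and
  the four central elements `C₊`, `C₋`, `Z(1)`, `Z(i)` (`GLnComplexCasimir.casPlus`, `casMinus`,
  `zedU`) act on ONE non-zero vector by the above four numbers, then the module HAS Harish-Chandra
  parameter `χ`. Proof: by Harish-Chandra's theorem (`exists_hasHCParameter_of_hasCentralCharacter`,
  proved in the tree) the module has some parameter `χ'`; comparing the scalars of
  `scalars_of_hasHCParameter` (through `lift_casPlus`, `lift_casMinus`, `lift_zedU` and the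
  factorisation `ofRho_rho`) with the hypotheses on the vector gives equal sums and sums of squares
  in each factor, hence equal multisets (`GL2Casimir.pair_eq_pair_of_add_eq_of_mul_eq`).

This is the step reading the archimedean component at a complex place of a cohomological automorphic
representation of `GL₂` off the scalars by which the two Casimir operators and the centre act on
`(𝔤, K_∞)`-cohomology (Harder 1987, §3.6; Borel–Wallach I.5.3), as `GL2CasimirParameter` does at a
real place for Maass / holomorphic forms. [cite: Knapp2002, §V.5 Thm. 5.44 and Prop. 5.32]

## References

* A. W. Knapp, *Lie Groups Beyond an Introduction*, 2nd ed. (2002), §V.4–V.5 (Prop. 5.32,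
  Thm. 5.44), §VI.1. [Knapp2002]
* G. Harder, *Eisenstein cohomology of arithmetic groups. The case GL₂*, Invent. Math. 89 (1987),
  §3.5–3.6. [Harder1987]
-/

noncomputable section

-- Mathlib idiom (Mathlib/Algebra/Lie/OfAssociative.lean), as in `GL2ComplexCasimirScalar`: commutator
-- brackets on matrix algebras and on `Module.End`.
attribute [local instance 100] LieRing.ofAssociativeRing

open scoped Matrix ComplexConjugate
open UniversalEnvelopingAlgebra Complex

namespace Literature.NumberTheory.Automorphic

namespace GL2ComplexCasimir

open HCSpan HCWt GLnComplexCasimir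

/-- The conjugation `ℂ → ℂ` as a real algebra homomorphism (local notation). -/
local notation "σ⁻" => (Complex.conjAe : ℂ →ₐ[ℝ] ℂ)
/-- The identity `ℂ → ℂ` as a real algebra homomorphism (local notation). -/
local notation "σ⁺" => AlgHom.id ℝ ℂ

variable {V : Type*} [AddCommGroup V] [Module ℂ V]
  (ρ : Matrix (Fin 2) (Fin 2) ℂ →ₗ⁅ℝ⁆ Module.End ℂ V)

/-- Cancelling a non-zero vector: `a • v = b • v`, `v ≠ 0` ⟹ `a = b`. [folklore] -/
theorem smul_left_cancel_of_ne_zero {v : V} (hv : v ≠ 0) {a b : ℂ} (h : a • v = b • v) : a = b := by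
  rw [← sub_eq_zero, ← sub_smul, smul_eq_zero] at h
  exact sub_eq_zero.mp (h.resolve_right hv)

/-- **The Harish-Chandra parameter of a `𝔤𝔩₂(ℂ)`-module from the scalars of `C₊`, `C₋`, `Z(1)`,
`Z(i)` on one vector.** Let `ρ` be a real Lie algebra representation of `𝔤𝔩₂(ℂ)` on a complex
space on which the centre of `U_ℝ(𝔤𝔩₂(ℂ))` acts through a character (`HasCentralCharacter`; e.g.
an irreducible admissible `(𝔤, K)`-module, or the archimedean component at a complex place of an
automorphic representation). If for ONE non-zero vector `v` the two real Casimir elements and the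
centre act by the values of their Harish-Chandra polynomials at `(s, t)`,
`C₊ v = 2((s₁²+s₂²-½) + (t₁²+t₂²-½)) v`, `C₋ v = 2i((s₁²+s₂²-½) - (t₁²+t₂²-½)) v`,
`Z(1) v = ((s₁+s₂) + (t₁+t₂)) v`, `Z(i) v = i((s₁+s₂) - (t₁+t₂)) v`, then `ρ` has Harish-Chandra
parameter `χ` with `χ(id) = {s₁, s₂}`, `χ(conj) = {t₁, t₂}`: by Harish-Chandra's theorem
(`exists_hasHCParameter_of_hasCentralCharacter`) `ρ` has SOME parameter `χ'`, whose scalars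
(`scalars_of_hasHCParameter`, `lift_casPlus`, `lift_casMinus`, `lift_zedU`) compared on `v` give the
same sums and sums of squares in each factor, hence the same multisets. The complex-place
companion of `GL2Casimir.hasHCParameter_of_lift_casimir_of_lift_zed`.
[cite: Knapp2002, §V.5 Thm. 5.44 and Prop. 5.32] -/
theorem hasHCParameter_of_lift_scalars
    {θ : Subalgebra.center ℝ (UniversalEnvelopingAlgebra ℝ (Matrix (Fin 2) (Fin 2) ℂ)) →ₐ[ℝ] ℂ}
    (hθ : HasCentralCharacter ρ θ) {v : V} (hv : v ≠ 0) {χ : (ℂ →ₐ[ℝ] ℂ) → Multiset ℂ}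
    {s₁ s₂ t₁ t₂ : ℂ} (hs : χ σ⁺ = {s₁, s₂}) (ht : χ σ⁻ = {t₁, t₂})
    (hP : lift ℝ ρ (casPlus 2) v =
      (2 * ((s₁ ^ 2 + s₂ ^ 2 - 1 / 2) + (t₁ ^ 2 + t₂ ^ 2 - 1 / 2))) • v)
    (hM : lift ℝ ρ (casMinus 2) v =
      (2 * I * ((s₁ ^ 2 + s₂ ^ 2 - 1 / 2) - (t₁ ^ 2 + t₂ ^ 2 - 1 / 2))) • v)
    (hZ1 : lift ℝ ρ (zedU 2 1) v = ((s₁ + s₂) + (t₁ + t₂)) • v)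
    (hZI : lift ℝ ρ (zedU 2 I) v = (I * ((s₁ + s₂) - (t₁ + t₂))) • v) :
    HasHCParameter ρ χ := by
  classical
  obtain ⟨χ', hχ'⟩ := exists_hasHCParameter_of_hasCentralCharacter ρ hθ
  obtain ⟨s₁', s₂', hs'⟩ : ∃ a b, χ' σ⁺ = {a, b} :=
    Multiset.card_eq_two.mp (card_eq_of_hasHCParameter ρ hχ' σ⁺)
  obtain ⟨t₁', t₂', ht'⟩ : ∃ a b, χ' σ⁻ = {a, b} :=
    Multiset.card_eq_two.mp (card_eq_of_hasHCParameter ρ hχ' σ⁻)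
  obtain ⟨⟨hL1, hR1⟩, hCL, hCR⟩ := scalars_of_hasHCParameter ρ hχ' hs' ht'
  -- the four scalars in terms of the primed parameters
  have eP : lift ℝ ρ (casPlus 2) v =
      (2 * ((s₁' ^ 2 + s₂' ^ 2 - 1 / 2) + (t₁' ^ 2 + t₂' ^ 2 - 1 / 2))) • v := by
    conv_lhs => rw [← ofRho_rho ρ, lift_casPlus, hCL, hCR]
    simp only [LinearMap.smul_apply, LinearMap.add_apply, Module.End.one_apply]
    module
  have eM : lift ℝ ρ (casMinus 2) v =
      (2 * I * ((s₁' ^ 2 + s₂' ^ 2 - 1 / 2) - (t₁' ^ 2 + t₂' ^ 2 - 1 / 2))) • v := by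
    conv_lhs => rw [← ofRho_rho ρ, lift_casMinus, hCL, hCR]
    simp only [LinearMap.smul_apply, LinearMap.sub_apply, Module.End.one_apply]
    module
  have eZ1 : lift ℝ ρ (zedU 2 1) v = ((s₁' + s₂') + (t₁' + t₂')) • v := by
    conv_lhs => rw [← ofRho_rho ρ, lift_zedU, hL1, hR1]
    simp only [map_one, LinearMap.smul_apply, LinearMap.add_apply, Module.End.one_apply, smul_smul,
      one_mul]
    module
  have eZI : lift ℝ ρ (zedU 2 I) v = (I * ((s₁' + s₂') - (t₁' + t₂'))) • v := by
    conv_lhs => rw [← ofRho_rho ρ, lift_zedU, hL1, hR1]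
    simp only [conj_I, LinearMap.smul_apply, LinearMap.add_apply, Module.End.one_apply, smul_smul]
    module
  -- compare on `v`
  have cP := smul_left_cancel_of_ne_zero hv (eP.symm.trans hP)
  have cM := smul_left_cancel_of_ne_zero hv (eM.symm.trans hM)
  have cZ1 := smul_left_cancel_of_ne_zero hv (eZ1.symm.trans hZ1)
  have cZI := smul_left_cancel_of_ne_zero hv (eZI.symm.trans hZI)
  -- solve: sums and sums of squares agree in each factor
  have hsum_s : s₁' + s₂' = s₁ + s₂ := by
    linear_combination (1 / 2 : ℂ) * cZ1 - (I / 2) * cZI +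
      ((s₁' + s₂' - (t₁' + t₂') - (s₁ + s₂) + (t₁ + t₂)) / 2) * Complex.I_sq
  have hsum_t : t₁' + t₂' = t₁ + t₂ := by
    linear_combination (1 / 2 : ℂ) * cZ1 + (I / 2) * cZI -
      ((s₁' + s₂' - (t₁' + t₂') - (s₁ + s₂) + (t₁ + t₂)) / 2) * Complex.I_sq
  have hsq_s : s₁' ^ 2 + s₂' ^ 2 = s₁ ^ 2 + s₂ ^ 2 := by
    linear_combination (1 / 4 : ℂ) * cP - (I / 4) * cM +
      (((s₁' ^ 2 + s₂' ^ 2) - (t₁' ^ 2 + t₂' ^ 2) - (s₁ ^ 2 + s₂ ^ 2) + (t₁ ^ 2 + t₂ ^ 2)) / 2) *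
        Complex.I_sq
  have hsq_t : t₁' ^ 2 + t₂' ^ 2 = t₁ ^ 2 + t₂ ^ 2 := by
    linear_combination (1 / 4 : ℂ) * cP + (I / 4) * cM -
      (((s₁' ^ 2 + s₂' ^ 2) - (t₁' ^ 2 + t₂' ^ 2) - (s₁ ^ 2 + s₂ ^ 2) + (t₁ ^ 2 + t₂ ^ 2)) / 2) *
        Complex.I_sq
  have hmul_s : s₁' * s₂' = s₁ * s₂ := by
    linear_combination (1 / 2 : ℂ) * (s₁' + s₂' + s₁ + s₂) * hsum_s - (1 / 2 : ℂ) * hsq_s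
  have hmul_t : t₁' * t₂' = t₁ * t₂ := by
    linear_combination (1 / 2 : ℂ) * (t₁' + t₂' + t₁ + t₂) * hsum_t - (1 / 2 : ℂ) * hsq_t
  have hχ : χ' = χ := by
    funext τ
    rcases Complex.real_algHom_eq_id_or_conj τ with rfl | rfl
    · rw [hs', hs, GL2Casimir.pair_eq_pair_of_add_eq_of_mul_eq hsum_s hmul_s]
    · rw [ht', ht, GL2Casimir.pair_eq_pair_of_add_eq_of_mul_eq hsum_t hmul_t]
  rw [← hχ]
  exact hχ'

end GL2ComplexCasimir

end Literature.NumberTheory.Automorphic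

end
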